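import Literature.Analysis.FluidPDE.AxisymOmegaEnergy
import HarnessLib

/-!
# Transport integration by parts: `∫ a · Db[u] = −∫ Da[u] · b` for a divergence-free `u`

Analysis/FluidPDE support file (theorems only; no definitions, no named facts) on the discharge
path of the named facts `Literature.Analysis.FluidPDE.LeiZhang2017_logModulus_regularity`,
`…LeiZhang2017_smallSwirl_regularity`, `…Wei2016_logModulus_regularity`. The weighted energy
estimates of Lei–Zhang 2017, §3 (arXiv p. 9: the `L⁴` estimate of `v^θ`,
"`d/dt‖v^θ‖⁴_{L⁴} + … ≤ C|∫ vʳ(v^θ)⁴/r|`", and the `ω^θ` estimate) pair the transport terms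
`(b·∇)` against multipliers other than the solution itself; the transport term is then moved by

* `integral_mul_mul_fderiv_coord_eq_neg` — one coordinate: `∫ a uᵢ ∂ᵢb = −∫ (∂ᵢa uᵢ + a ∂ᵢuᵢ) b`;
* `integral_mul_fderiv_apply_eq_neg_of_isDivFree'` — **`∫ a · Db[u] = −∫ Da[u] · b`** for
  `a, b ∈ C¹`, `u ∈ C¹` divergence-free, bounded with bounded derivative, and the products
  `a b`, `∂ᵢa · b`, `a · ∂ᵢb` integrable (the diagonal case `a = b` is the tree's
  `integral_mul_fderiv_apply_eq_zero_of_isDivFree`).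

## Mathlib / tree search

Tree: `two_mul_integral_coord_mul_mul_fderiv`, `fderiv_apply_eq_sum_three` (`AxisymOmegaEnergy`),
`divergence_eq_sum_three`, `fderiv_apply_coord_vec3`, `contDiff_apply_coord_vec3`
(`AxisymHouLiVariables`). Mathlib: `integral_mul_fderiv_eq_neg_fderiv_mul_of_integrable`,
`Integrable.bdd_mul`.

## References

* Z. Lei, Q. S. Zhang, Pacific J. Math. 289 (2017) 169–187, arXiv:1505.02628, §3, p. 9.
  [`LeiZhang2017`]
-/

noncomputable section

open MeasureTheory Set Function Filter Topology InnerProductSpace WithLp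
open scoped RealInnerProductSpace ContDiff ENNReal

namespace Literature.Analysis.FluidPDE

section Transport

variable {a b : EuclideanSpace ℝ (Fin 3) → ℝ} {u : EuclideanSpace ℝ (Fin 3) → EuclideanSpace ℝ (Fin 3)}

/-- **One coordinate**: `∫ a uᵢ ∂ᵢb = −∫ (∂ᵢa uᵢ + a ∂ᵢuᵢ) b` for `a, b, u ∈ C¹`, `u`, `Du`
bounded, `a b`, `∂ᵢa b`, `a ∂ᵢb` integrable. [folklore] -/
theorem integral_mul_mul_fderiv_coord_eq_neg (ha : ContDiff ℝ 1 a) (hb : ContDiff ℝ 1 b)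
    (hu : ContDiff ℝ 1 u) (i : Fin 3) {B : ℝ} (huB : ∀ x, ‖u x‖ ≤ B) {B' : ℝ}
    (hDu : ∀ x, ‖fderiv ℝ u x‖ ≤ B') (hab : Integrable (fun x => a x * b x))
    (hDab : Integrable (fun x => fderiv ℝ a x (EuclideanSpace.single i 1) * b x))
    (haDb : Integrable (fun x => a x * fderiv ℝ b x (EuclideanSpace.single i 1))) :
    ∫ x, a x * u x i * fderiv ℝ b x (EuclideanSpace.single i 1) =
      -∫ x, (fderiv ℝ a x (EuclideanSpace.single i 1) * u x i +
        a x * fderiv ℝ u x (EuclideanSpace.single i 1) i) * b x := by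
  set e : EuclideanSpace ℝ (Fin 3) := EuclideanSpace.single i 1 with he
  have had : Differentiable ℝ a := ha.differentiable one_ne_zero
  have hbd : Differentiable ℝ b := hb.differentiable one_ne_zero
  have hud : Differentiable ℝ u := hu.differentiable one_ne_zero
  have hui : ContDiff ℝ 1 fun x => u x i := contDiff_apply_coord_vec3 hu i
  have huid : Differentiable ℝ fun x => u x i := hui.differentiable one_ne_zero
  have hF : Differentiable ℝ fun x => a x * u x i := had.mul huid
  have hDF : ∀ x, fderiv ℝ (fun y => a y * u y i) x e =
      fderiv ℝ a x e * u x i + a x * fderiv ℝ u x e i := by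
    intro x
    rw [fderiv_fun_mul (had x) (huid x)]
    simp only [_root_.add_apply, _root_.FunLike.coe_smul, Pi.smul_apply, smul_eq_mul,
      fderiv_apply_coord_vec3 (hud x) i e]
    ring
  -- bounded factors
  have huiB : ∀ x, ‖u x i‖ ≤ B := fun x => (PiLp.norm_apply_le (u x) i).trans (huB x)
  have hDuiB : ∀ x, ‖fderiv ℝ u x e i‖ ≤ B' := fun x => by
    calc ‖fderiv ℝ u x e i‖ ≤ ‖fderiv ℝ u x e‖ := PiLp.norm_apply_le _ i
      _ ≤ ‖fderiv ℝ u x‖ * ‖e‖ := (fderiv ℝ u x).le_opNorm e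
      _ = ‖fderiv ℝ u x‖ := by rw [he]; simp
      _ ≤ B' := hDu x
  have huim : AEStronglyMeasurable (fun x => u x i) volume := huid.continuous.aestronglyMeasurable
  have hDuc : ContDiff ℝ 0 fun x => fderiv ℝ u x e :=
    contDiff_zero.2 ((hu.continuous_fderiv one_ne_zero).clm_apply continuous_const)
  have hDuim : AEStronglyMeasurable (fun x => fderiv ℝ u x e i) volume :=
    (contDiff_apply_coord_vec3 hDuc i).continuous.aestronglyMeasurable
  -- integrable products
  have i1 : Integrable (fun x => u x i * (fderiv ℝ a x e * b x)) volume :=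
    hDab.bdd_mul huim (ae_of_all _ huiB)
  have i2 : Integrable (fun x => fderiv ℝ u x e i * (a x * b x)) volume :=
    hab.bdd_mul hDuim (ae_of_all _ hDuiB)
  have i3 : Integrable (fun x => u x i * (a x * fderiv ℝ b x e)) volume :=
    haDb.bdd_mul huim (ae_of_all _ huiB)
  have i4 : Integrable (fun x => u x i * (a x * b x)) volume := hab.bdd_mul huim (ae_of_all _ huiB)
  have hibp := integral_mul_fderiv_eq_neg_fderiv_mul_of_integrable (μ := volume)
    (f := fun x => a x * u x i) (g := b) (v := e) ?_ ?_ ?_ (fun x _ => hF x) (fun x _ => hbd x)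
  rotate_left
  · have i12 : Integrable (fun x => u x i * (fderiv ℝ a x e * b x) + fderiv ℝ u x e i * (a x * b x))
        volume := i1.add i2
    refine i12.congr (Eventually.of_forall fun x => ?_)
    beta_reduce; rw [hDF x]; ring
  · exact i3.congr (Eventually.of_forall fun x => by beta_reduce; ring)
  · exact i4.congr (Eventually.of_forall fun x => by beta_reduce; ring)
  have hR : ∫ x, fderiv ℝ (fun y => a y * u y i) x e * b x =
      ∫ x, (fderiv ℝ a x e * u x i + a x * fderiv ℝ u x e i) * b x :=
    integral_congr_ae (Eventually.of_forall fun x => by beta_reduce; rw [hDF x])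
  rw [hR] at hibp
  exact hibp

/-- **Transport integration by parts**: `∫ a · Db[u] = −∫ Da[u] · b` on `ℝ³` for `a, b ∈ C¹`,
a divergence-free `u ∈ C¹` that is bounded with bounded derivative, and integrable products
`a b`, `∂ᵢa · b`, `a · ∂ᵢb` (`i = 0, 1, 2`). [folklore] -/
theorem integral_mul_fderiv_apply_eq_neg_of_isDivFree' (ha : ContDiff ℝ 1 a) (hb : ContDiff ℝ 1 b)
    (hu : ContDiff ℝ 1 u) (hdiv : VectorCalculus.IsDivFree u) {B : ℝ} (huB : ∀ x, ‖u x‖ ≤ B)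
    {B' : ℝ} (hDu : ∀ x, ‖fderiv ℝ u x‖ ≤ B') (hab : Integrable (fun x => a x * b x))
    (hDab : ∀ i : Fin 3, Integrable (fun x => fderiv ℝ a x (EuclideanSpace.single i 1) * b x))
    (haDb : ∀ i : Fin 3, Integrable (fun x => a x * fderiv ℝ b x (EuclideanSpace.single i 1))) :
    ∫ x, a x * fderiv ℝ b x (u x) = -∫ x, fderiv ℝ a x (u x) * b x := by
  have hud : Differentiable ℝ u := hu.differentiable one_ne_zero
  have hS := fun i => integral_mul_mul_fderiv_coord_eq_neg ha hb hu i huB hDu hab (hDab i) (haDb i)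
  have huid : ∀ i : Fin 3, Differentiable ℝ fun x => u x i := fun i =>
    (contDiff_apply_coord_vec3 hu i).differentiable one_ne_zero
  have huiB : ∀ (i : Fin 3) x, ‖u x i‖ ≤ B := fun i x => (PiLp.norm_apply_le (u x) i).trans (huB x)
  have huim : ∀ i : Fin 3, AEStronglyMeasurable (fun x => u x i) volume := fun i =>
    (huid i).continuous.aestronglyMeasurable
  have hDuc : ∀ i : Fin 3, ContDiff ℝ 0 fun x => fderiv ℝ u x (EuclideanSpace.single i 1) := fun i =>
    contDiff_zero.2 ((hu.continuous_fderiv one_ne_zero).clm_apply continuous_const)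
  have hDuiB : ∀ (i : Fin 3) x, ‖fderiv ℝ u x (EuclideanSpace.single i 1) i‖ ≤ B' := fun i x => by
    calc ‖fderiv ℝ u x (EuclideanSpace.single i 1) i‖
        ≤ ‖fderiv ℝ u x (EuclideanSpace.single i 1)‖ := PiLp.norm_apply_le _ i
      _ ≤ ‖fderiv ℝ u x‖ * ‖(EuclideanSpace.single i 1 : EuclideanSpace ℝ (Fin 3))‖ :=
          (fderiv ℝ u x).le_opNorm _
      _ = ‖fderiv ℝ u x‖ := by simp
      _ ≤ B' := hDu x
  -- integrable pieces
  have iL : ∀ i : Fin 3, Integrable (fun x => a x * u x i * fderiv ℝ b x (EuclideanSpace.single i 1))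
      volume := fun i => by
    have h := (haDb i).bdd_mul (huim i) (ae_of_all _ (huiB i))
    exact h.congr (Eventually.of_forall fun x => by beta_reduce; ring)
  have iR1 : ∀ i : Fin 3, Integrable (fun x => fderiv ℝ a x (EuclideanSpace.single i 1) * u x i * b x)
      volume := fun i => by
    have h := (hDab i).bdd_mul (huim i) (ae_of_all _ (huiB i))
    exact h.congr (Eventually.of_forall fun x => by beta_reduce; ring)
  have iR2 : ∀ i : Fin 3, Integrable (fun x => a x * fderiv ℝ u x (EuclideanSpace.single i 1) i * b x)
      volume := fun i => by
    have h := hab.bdd_mul ((contDiff_apply_coord_vec3 (hDuc i) i).continuous.aestronglyMeasurable)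
      (ae_of_all _ (hDuiB i))
    exact h.congr (Eventually.of_forall fun x => by beta_reduce; ring)
  -- `Σᵢ ∫ a ∂ᵢuᵢ b = ∫ a (div u) b = 0`
  have hdivint : (∫ x, a x * fderiv ℝ u x (EuclideanSpace.single 0 1) 0 * b x) +
      (∫ x, a x * fderiv ℝ u x (EuclideanSpace.single 1 1) 1 * b x) +
      (∫ x, a x * fderiv ℝ u x (EuclideanSpace.single 2 1) 2 * b x) = 0 := by
    have i01 : Integrable (fun x => a x * fderiv ℝ u x (EuclideanSpace.single 0 1) 0 * b x +
        a x * fderiv ℝ u x (EuclideanSpace.single 1 1) 1 * b x) volume := (iR2 0).add (iR2 1)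
    rw [← integral_add (iR2 0) (iR2 1), ← integral_add i01 (iR2 2)]
    refine integral_eq_zero_of_ae (Eventually.of_forall fun x => ?_)
    have h := divergence_eq_sum_three u x
    rw [hdiv x] at h
    simp only [Pi.zero_apply]
    have : fderiv ℝ u x (EuclideanSpace.single 0 1) 0 + fderiv ℝ u x (EuclideanSpace.single 1 1) 1 +
        fderiv ℝ u x (EuclideanSpace.single 2 1) 2 = 0 := h.symm
    calc a x * fderiv ℝ u x (EuclideanSpace.single 0 1) 0 * b x +
          a x * fderiv ℝ u x (EuclideanSpace.single 1 1) 1 * b x +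
          a x * fderiv ℝ u x (EuclideanSpace.single 2 1) 2 * b x
        = a x * b x * (fderiv ℝ u x (EuclideanSpace.single 0 1) 0 +
            fderiv ℝ u x (EuclideanSpace.single 1 1) 1 + fderiv ℝ u x (EuclideanSpace.single 2 1) 2) := by
          ring
      _ = 0 := by rw [this, mul_zero]
  -- the left side in coordinates
  have hL : ∫ x, a x * fderiv ℝ b x (u x) =
      (∫ x, a x * u x 0 * fderiv ℝ b x (EuclideanSpace.single 0 1)) +
      (∫ x, a x * u x 1 * fderiv ℝ b x (EuclideanSpace.single 1 1)) +
      (∫ x, a x * u x 2 * fderiv ℝ b x (EuclideanSpace.single 2 1)) := by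
    have i01 : Integrable (fun x => a x * u x 0 * fderiv ℝ b x (EuclideanSpace.single 0 1) +
        a x * u x 1 * fderiv ℝ b x (EuclideanSpace.single 1 1)) volume := (iL 0).add (iL 1)
    rw [← integral_add (iL 0) (iL 1), ← integral_add i01 (iL 2)]
    refine integral_congr_ae (Eventually.of_forall fun x => ?_)
    beta_reduce
    rw [fderiv_apply_eq_sum_three b x (u x)]
    ring
  -- the right side in coordinates
  have hR : ∫ x, fderiv ℝ a x (u x) * b x =
      (∫ x, fderiv ℝ a x (EuclideanSpace.single 0 1) * u x 0 * b x) +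
      (∫ x, fderiv ℝ a x (EuclideanSpace.single 1 1) * u x 1 * b x) +
      (∫ x, fderiv ℝ a x (EuclideanSpace.single 2 1) * u x 2 * b x) := by
    have i01 : Integrable (fun x => fderiv ℝ a x (EuclideanSpace.single 0 1) * u x 0 * b x +
        fderiv ℝ a x (EuclideanSpace.single 1 1) * u x 1 * b x) volume := (iR1 0).add (iR1 1)
    rw [← integral_add (iR1 0) (iR1 1), ← integral_add i01 (iR1 2)]
    refine integral_congr_ae (Eventually.of_forall fun x => ?_)
    beta_reduce
    rw [fderiv_apply_eq_sum_three a x (u x)]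
    ring
  -- each unit identity, split its right side
  have hS' : ∀ i : Fin 3, ∫ x, a x * u x i * fderiv ℝ b x (EuclideanSpace.single i 1) =
      -(∫ x, fderiv ℝ a x (EuclideanSpace.single i 1) * u x i * b x) -
        ∫ x, a x * fderiv ℝ u x (EuclideanSpace.single i 1) i * b x := by
    intro i
    rw [hS i]
    have : ∫ x, (fderiv ℝ a x (EuclideanSpace.single i 1) * u x i +
        a x * fderiv ℝ u x (EuclideanSpace.single i 1) i) * b x =
        (∫ x, fderiv ℝ a x (EuclideanSpace.single i 1) * u x i * b x) +
          ∫ x, a x * fderiv ℝ u x (EuclideanSpace.single i 1) i * b x := by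
      rw [← integral_add (iR1 i) (iR2 i)]
      exact integral_congr_ae (Eventually.of_forall fun x => by beta_reduce; ring)
    rw [this]
    ring
  rw [hL, hR, hS' 0, hS' 1, hS' 2]
  linarith [hdivint]

end Transport

end Literature.Analysis.FluidPDE
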